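import Summits.ResolutionOfSingularities.ResolutionOfSingularities.Theorems.UniformComplexityCampaignW82SeparableTightness
import Summits.ResolutionOfSingularities.ResolutionOfSingularities.Theorems.UniformComplexityCampaignW82FamilyResolutionLinks
import Summits.ResolutionOfSingularities.ResolutionOfSingularities.Theorems.UniversalCellsCampaignW82FamilyResolutionInsepLinks
import HarnessLib

/-!
# [OURS · L1 W8.2] Separable tightness of resolution in families — by-name links to the crux slices
# (Theses-importing leaf)

Cell `res-hironaka` (run/shared/lean/pub/res-hironaka/), LADDER-RESOLUTION rung L (RESCUE), slot W8.2, doors 2 and 1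
(`UniformComplexity` / `PrimeModelTransfer` stmt-ResolutionOfSingularities-8933; `UniversalCells` / `PrimeFieldToPerfect`
stmt-ResolutionOfSingularities-15233); prover res-L1-s82-pv-2 (gen 7). LEAF module: imports the gen-7 headline
`…SeparableTightness` (`not_familyResolutionSep`) and the by-name link files `…FamilyResolutionLinks` (p532272, door 2:
`primeModelTransfer_iff_familyResolution`, `familyResolution_iff_algClosedRes`) and `…FamilyResolutionInsepLinks`
(p535806, door 1: `perfectRes_iff_familyResolutionInsep`, `familyResolution_of_familyResolutionInsep`), which import the
route files `Theses/UniformComplexity.lean` / `Theses/UniversalCells.lean`; nothing imports this file.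

CONTENT — the separable tightness READ AGAINST THE CRUX SLICES, by name:
* `familyResolution_and_not_sep_of_algClosedRes` — `AlgClosedRes p` ⇒ for every `k` of characteristic `p`:
  `FamilyResolution k ∧ ¬ FamilyResolutionSep k` (resolution in families holds, and its base extensions cannot all
  be separable).
* `primeModelTransfer_familyResolution_inseparable` — **the crux `PrimeModelTransfer` ⇒ for every prime `p` with
  `PrimeClosureRes p`: `FamilyResolution 𝔽̄_p ∧ ¬ FamilyResolutionSep 𝔽̄_p`**: IF the crux holds, the base extensions in the
  resolution in families it is equivalent to (p532272) are inseparable for some families — by the gen-7 theorem, for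
  the compactified Kollár pencil.
* `perfectRes_familyResolutionInsep_and_not_sep` — door 1: `PerfectRes p` ⇒ `FamilyResolutionInsep p (ZMod p)` (radicial
  base extensions suffice, p535806) `∧ ¬ FamilyResolutionSep (ZMod p)` (separable ones do not): the inseparability of the
  base extension is pinned on both sides.
* `familyResolutionSep_iff_false` — for the record: in characteristic `p`, `FamilyResolutionSep k ↔ False`.

HONEST FRAMING. OURS by-name bookkeeping; NOT a statement of H. Hironaka's 2017 manuscript ([Hironaka2017]); nothing
here is attributed to its author; no claim about the crux (open problem). AI work, weaker than expert review.

## References (locators only)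
* J. Kollár, *Lectures on Resolution of Singularities* (2007), 1.19. [Kollar2007]
-/

noncomputable section

set_option linter.dupNamespace false -- mandated namespace of this single-conjunct summit

open _root_.CategoryTheory _root_.CategoryTheory.Limits _root_.AlgebraicGeometry
open Summit.ResolutionOfSingularities.ResolutionOfSingularities.Theses.UniformComplexity (PrimeModelTransfer)

namespace Summit.ResolutionOfSingularities.ResolutionOfSingularities.Theorems.CampaignW82

/-- For the record: in characteristic `p > 0`, `FamilyResolutionSep k ↔ False` (`not_familyResolutionSep`). [folklore] -/
theorem familyResolutionSep_iff_false (k : Type) [Field k] (p : ℕ) [Fact p.Prime] [CharP k p] :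
    FamilyResolutionSep k ↔ False :=
  ⟨SeparableTightness.not_familyResolutionSep k p, False.elim⟩

/-- **`AlgClosedRes p` ⇒ resolution in families holds over every field of characteristic `p`, and its base extensions
cannot all be separable**: `FamilyResolution k ∧ ¬ FamilyResolutionSep k` (`familyResolution_of_algClosedRes`, p532272,
and the gen-7 separable tightness). [folklore] -/
theorem familyResolution_and_not_sep_of_algClosedRes (p : ℕ) [Fact p.Prime] (h : AlgClosedRes p)
    (k : Type) [Field k] [CharP k p] : FamilyResolution k ∧ ¬ FamilyResolutionSep k :=
  ⟨familyResolution_of_algClosedRes p h k, SeparableTightness.not_familyResolutionSep k p⟩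

/-- **THE CRUX FORCES INSEPARABLE BASE EXTENSIONS.** If `Theses.UniformComplexity.PrimeModelTransfer` (stmt-8933) holds,
then for every prime `p` with resolution over `𝔽̄_p` (`PrimeClosureRes p`): resolution in families over `𝔽̄_p` holds
(`primeModelTransfer_iff_familyResolution`, p532272) AND its variant with separable base extensions fails
(`not_familyResolutionSep`) — the algebraic base extensions `A → A'` the crux is equivalent to are inseparable for
some proper families with integral geometric generic fibre (the compactified Kollár pencil over `𝔽̄_p[t]`).
No claim about the crux itself. [cite: Kollar2007, 1.19] -/
theorem primeModelTransfer_familyResolution_inseparable (h : PrimeModelTransfer) (p : ℕ) [Fact p.Prime]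
    (hres : PrimeClosureRes p) :
    FamilyResolution (AlgebraicClosure (ZMod p)) ∧ ¬ FamilyResolutionSep (AlgebraicClosure (ZMod p)) :=
  ⟨primeModelTransfer_iff_familyResolution.mp h p hres,
    SeparableTightness.not_familyResolutionSep_algebraicClosure_zmod p⟩

/-- **Door 1: the inseparability is pinned on both sides.** `PerfectRes p` (resolution of reduced separated finite-type
schemes over every perfect field of characteristic `p`, `Theorems.PerfectRes`) ⇒ the RADICIAL family form holds over
`𝔽_p` (`perfectRes_iff_familyResolutionInsep`, p535806) while the SEPARABLE family form fails over `𝔽_p`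
(`not_familyResolutionSep`). [folklore] -/
theorem perfectRes_familyResolutionInsep_and_not_sep (p : ℕ) [Fact p.Prime]
    (h : Summit.ResolutionOfSingularities.ResolutionOfSingularities.Theorems.PerfectRes p) :
    FamilyResolutionInsep p (ZMod p) ∧ ¬ FamilyResolutionSep (ZMod p) :=
  ⟨(perfectRes_iff_familyResolutionInsep p).mp h, SeparableTightness.not_familyResolutionSep (ZMod p) p⟩

end Summit.ResolutionOfSingularities.ResolutionOfSingularities.Theorems.CampaignW82

end
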